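import Summits.QuantumFields.GaugeBoot.TiltedBoxEvenMidAxisRPTwoDimPrep
import Summits.QuantumFields.GaugeBoot.TiltedBoxOddAxisRPTwoDim
import Literature.MathematicalPhysics.QuantumFieldTheory.LatticeSiteRPMechanism
import HarnessLib

/-!
# The link mirror of the even square tilted box IS reflection positive in two dimensions (gauge-boot, L3 supplement: 2D slab gluing, even side 3/3)

HONEST FRAMING (cell `pub-gaugeboot`, page 1 of every file): the venture produces certified bounds
on lattice expectations at stated coupling, gauge group, dimension and torus size; NOT a mass gap,
NOT a continuum limit, NOT a string tension; NOT Yang–Mills-summit-bearing (barriers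
`FixedCouplingUltralocality`, `PerturbativeInvisibility`). A structural POSITIVE result about a
reflection of a two-dimensional periodic box; it bounds no expectation of the venture's tables.

`TiltedBoxEvenMidAxisRPNegative.lean` proved: on the square tilted box `ℤ^d/Γ(2P, 2P, L)`, `P ≥ 2`, in
`d ≥ 3` the in-plane LINK mirror `x_i ↦ 1 - x_i` (slab `0|1` exact, slab `P|P+1` TWISTED by
`T = [2P e_j]`) is NOT of positive type for the closed half `{1 ≤ x_i ≤ P}` at any `β > 0`. This module
proves the two-dimensional positive statement, the even-side twin of `tiltedBox_axisRP_odd_twoDim`: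

* **`tiltedBox_midAxisRP_twoDim`** — two directions (`∀ k, k = i ∨ k = j`), `P ≥ 2`, every compact second
  countable `G`, every continuous `ρ`, EVERY real `β`: `0 ≤ ∫ conj F(Θ_mid U) · F(U) dμ_β` for every
  bounded measurable observable `F` of `{1 ≤ x_i ≤ P}` (`IsMidObservable … P (axisCoord d L (2P))`, exactly
  the shape refuted in `d ≥ 3` by `not_tiltedBox_midAxisRP`).

**Proof.** As on the odd box (`TiltedBoxOddAxisRPTwoDim.lean`), with TWO annuli and no shared block: the
Boltzmann weight splits into `h = g·conj(g∘Θ)` (`g = F e^{-βE}`, `E = midExpo`) and the two annulus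
products (`boltzmann_split_mid`); Migdal's recursion integrates the rungs of both annuli
(`SlabKernel.integral_mul_annulus`, twice), leaving `k_ψ(w₀, w₁) · k_ψ(w_P, w_{P+1})`, `ψ = ω_β^{⋆2P}`, of the
layer words; the lower slab is exact (`w₁ ∘ Θ = w₀`, so `k_ψ(w₀, w₁) = k_ψ(w₁, w₁ ∘ Θ)` by symmetry of `k_ψ`)
and the upper one twisted (`w_{P+1}` is a conjugate of `w_P ∘ Θ`, invisible to `k_ψ`); the Gram form of
`k_ψ` (`SlabKernelGram`) turns the integral into `∫∫ (∫ Ψ_{u,u'} conj(Ψ_{u,u'} ∘ Θ) dμ₀) du du'` with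
`Ψ_{u,u'} = g · e_ψ(w₁, u) · e_ψ(w_P, u')` an observable of the positive links, and the tree's mechanism
`LatticeRP.integral_splice_mul_conj_comp_of_shared_nonneg` (empty shared block, no crossing links)
makes each inner integral non-negative. No character expansion, no sign condition on `β`.

With `tiltedBox_axisRP_odd_twoDim`: BOTH twisted-slab in-plane mirrors of the square tilted boxes, which
fail in `d ≥ 3` for `β > 0`, HOLD in `d = 2` at every `β`; the two twisted-layer mirrors fail in every
`d ≥ 2`. Small new positive result; mechanism folklore (Migdal 1975, Osterwalder–Seiler 1978).

References: A. A. Migdal, Sov. Phys. JETP 42 (1975) 413; K. Osterwalder, E. Seiler, Ann. Phys. 110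
(1978) 440, §2; J. Fröhlich, R. Israel, E. H. Lieb, B. Simon, J. Stat. Phys. 22 (1980) 297, §3;
M. Biskup, in LNM 1970 (2009) §5.4–5.5.
-/

noncomputable section

open MeasureTheory Complex Function
open scoped ComplexOrder ComplexConjugate
open Literature.MathematicalPhysics.QuantumFieldTheory (haarProbability)
open Literature.MathematicalPhysics.QuantumFieldTheory.LatticeRP (piMeasure splice splice_eq_piecewise
  integral_splice_mul_conj_comp_of_shared_nonneg)
open Literature.RepresentationTheory.CompactGroups

namespace Summit.QuantumFields.GaugeBoot

namespace TiltedRP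

namespace TwoDim

variable {d : ℕ} {i j : Fin d} {L P N : ℕ} [NeZero L] [NeZero P]
variable {G : Type*} [Group G] [TopologicalSpace G] [IsTopologicalGroup G] [CompactSpace G]
  [MeasurableSpace G] [BorelSpace G] [SecondCountableTopology G]
variable (ρ : G →* Matrix (Fin N) (Fin N) ℂ)

/-! ## The words of the layers `1` and `P`, the kernel weight -/

/-- The word of the layer `1` (upper letters of the lower annulus): `w₁(U) = ∏_{t<4P} U(t e_j + e_i, j)`. -/
def wLo (U : Config (TiltedSite d i j (2 * P) (2 * P) L) d G) : G :=
  SlabKernel.oprod (upAt (0 : TiltedSite d i j (2 * P) (2 * P) L)) (2 * (2 * P)) U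

/-- The word of the layer `P` (lower letters of the upper annulus): `w_P(U) = ∏_{t<4P} U(y₀ + t e_j, j)`. -/
def wUp (U : Config (TiltedSite d i j (2 * P) (2 * P) L) d G) : G :=
  SlabKernel.oprod (loAt (layerSite d L P : TiltedSite d i j (2 * P) (2 * P) L)) (2 * (2 * P)) U

variable (P) in
/-- The convolution power `ψ = ω_β^{⋆2P}` of the one-plaquette weight. -/
def psiW (β : ℝ) : G → ℝ := SlabKernel.convPow (SlabKernel.wilsonWt ρ β) (2 * P)

omit [NeZero L] [NeZero P] [CompactSpace G] [MeasurableSpace G] [BorelSpace G] [SecondCountableTopology G] in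
/-- The layer words are continuous. [folklore] -/
theorem continuous_wLo_wUp : Continuous (wLo (L := L) (P := P) (i := i) (j := j) (d := d) (G := G)) ∧
    Continuous (wUp (L := L) (P := P) (i := i) (j := j) (d := d) (G := G)) :=
  ⟨SlabKernel.continuous_oprod (fun _ => continuous_apply _) _, SlabKernel.continuous_oprod (fun _ => continuous_apply _) _⟩

/-! ## The two annuli are disjoint -/

omit [NeZero L] [NeZero P] in
/-- A rung of the upper slab is not a rung of the lower slab (`x_i = P ≠ 0`). [folklore] -/
theorem rungAt_layerSite_ne_rungAt_zero (hP : 2 ≤ P) (hij : i ≠ j) (t s : ℕ) :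
    rungAt (layerSite d L P : TiltedSite d i j (2 * P) (2 * P) L) t ≠ rungAt (0 : TiltedSite d i j (2 * P) (2 * P) L) s := by
  intro h
  have h1 := congrArg (fun l => (axisCoord d L (2 * P) l.1).val) h
  simp only [rungAt, axisCoord_cyc hij, axisCoord_layerSite, map_zero, ZMod.val_zero, ZMod.val_natCast,
    Nat.mod_eq_of_lt (show P < 2 * P by omega)] at h1
  omega

/-! ## Integrating the rungs of both annuli -/

/-- **Both annuli integrated, both twists removed**:
`∫ h · ∏_{upper} plaqWt · ∏_{lower} plaqWt dμ₀ = ∫ h · k_ψ(w₁, w₁∘Θ) · k_ψ(w_P, w_P∘Θ) dμ₀`. [folklore] -/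
theorem integral_hMid_annuli [DecidableEq (TiltedSite d i j (2 * P) (2 * P) L)] (hP : 2 ≤ P) (hij : i ≠ j)
    (hd : ∀ k : Fin d, k = i ∨ k = j) (hρ : Continuous ρ) (β : ℝ)
    {F : Config (TiltedSite d i j (2 * P) (2 * P) L) d G → ℂ} (hFm : Measurable F) {CF : ℝ} (hFb : ∀ U, ‖F U‖ ≤ CF)
    (hFo : IsMidObservable (tiltedUnit d i j (2 * P) (2 * P) L) P (axisCoord d L (2 * P)) F) :
    ∫ U, hMid ρ β F hij U *
        (∏ t ∈ Finset.range (2 * (2 * P)), SlabKernel.plaqWt (SlabKernel.wilsonWt ρ β)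
            (rungAt (layerSite d L P)) (loAt (layerSite d L P)) (upAt (layerSite d L P)) t U) *
        ∏ t ∈ Finset.range (2 * (2 * P)), SlabKernel.plaqWt (SlabKernel.wilsonWt ρ β)
            (rungAt (0 : TiltedSite d i j (2 * P) (2 * P) L)) (loAt 0) (upAt 0) t U
      ∂(productHaar (TiltedSite d i j (2 * P) (2 * P) L) d G) =
    ∫ U, hMid ρ β F hij U * (SlabKernel.slabKernel (psiW P ρ β) (wLo U)
        (wLo (configMidReflect (tiltedUnit d i j (2 * P) (2 * P) L) i (tiltedAxisFlip d L (2 * P) hij) U)) : ℂ) *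
      (SlabKernel.slabKernel (psiW P ρ β) (wUp U)
        (wUp (configMidReflect (tiltedUnit d i j (2 * P) (2 * P) L) i (tiltedAxisFlip d L (2 * P) hij) U)) : ℂ)
      ∂(productHaar (TiltedSite d i j (2 * P) (2 * P) L) d G) := by
  haveI : IsProbabilityMeasure (haarProbability G) := CompactGroup.isProbabilityMeasure_haarMeasure_top
  have hωc := SlabKernel.continuous_wilsonWt ρ hρ β
  have hωz := SlabKernel.wilsonWt_central ρ β
  have hωi := SlabKernel.wilsonWt_inv ρ hρ β
  have hψc : Continuous (psiW P ρ β) := SlabKernel.continuous_convPow hωc _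
  have hψz : ∀ g h, psiW P ρ β (h * g * h⁻¹) = psiW P ρ β g := SlabKernel.convPow_central hωz (2 * P)
  have hψi : ∀ g, psiW P ρ β g⁻¹ = psiW P ρ β g := SlabKernel.convPow_inv hωz hωi (2 * P)
  obtain ⟨C, -, hC⟩ := Literature.MathematicalPhysics.QuantumLattice.exists_forall_abs_le_of_continuous hωc
  obtain ⟨hhm, Ch, hhb⟩ := measurable_hMid_and_bound ρ hij hρ β hFm hFb
  have hm2 : (1 : ℕ) ≤ 2 * P := by omega
  -- Step A: the lower annulus, against `h₁ = h · ∏_{upper}`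
  set pU : Config (TiltedSite d i j (2 * P) (2 * P) L) d G → ℂ := fun U =>
    ∏ t ∈ Finset.range (2 * (2 * P)), SlabKernel.plaqWt (SlabKernel.wilsonWt ρ β)
      (rungAt (layerSite d L P)) (loAt (layerSite d L P)) (upAt (layerSite d L P)) t U with hpU
  have hpUm : Measurable pU := Finset.measurable_prod _ fun t _ =>
    (SlabKernel.continuous_plaqWt hωc (fun t => continuous_apply _) (fun t => continuous_apply _) t).measurable
  have hpUb : ∀ U, ‖pU U‖ ≤ C ^ (2 * (2 * P)) := fun U => by
    rw [hpU, norm_prod]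
    calc ∏ t ∈ Finset.range (2 * (2 * P)), ‖SlabKernel.plaqWt (SlabKernel.wilsonWt ρ β) (rungAt (layerSite d L P))
          (loAt (layerSite d L P)) (upAt (layerSite d L P)) t U‖ ≤ ∏ _t ∈ Finset.range (2 * (2 * P)), C :=
          Finset.prod_le_prod (fun _ _ => norm_nonneg _) fun t _ => SlabKernel.norm_plaqWt_le hC t U
      _ = C ^ (2 * (2 * P)) := by rw [Finset.prod_const, Finset.card_range]
  have hpUu : ∀ s U z, pU (update U (rungAt (0 : TiltedSite d i j (2 * P) (2 * P) L) s) z) = pU U := fun s U z => by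
    simp only [hpU]
    refine Finset.prod_congr rfl fun t _ => ?_
    exact SlabKernel.plaqWt_update_of_ne (rungAt_layerSite_ne_rungAt_zero hP hij _ _)
      (rungAt_layerSite_ne_rungAt_zero hP hij _ _) (fun U z => loAt_update hij _ _ _ _ U z)
      (fun U z => upAt_update hij _ _ _ _ U z) U z
  set h₁ : Config (TiltedSite d i j (2 * P) (2 * P) L) d G → ℂ := fun U => hMid ρ β F hij U * pU U with hh₁
  have hA : ∀ U, hMid ρ β F hij U *
      (∏ t ∈ Finset.range (2 * (2 * P)), SlabKernel.plaqWt (SlabKernel.wilsonWt ρ β)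
        (rungAt (layerSite d L P)) (loAt (layerSite d L P)) (upAt (layerSite d L P)) t U) *
      ∏ t ∈ Finset.range (2 * (2 * P)), SlabKernel.plaqWt (SlabKernel.wilsonWt ρ β)
        (rungAt (0 : TiltedSite d i j (2 * P) (2 * P) L)) (loAt 0) (upAt 0) t U =
      h₁ U * ∏ t ∈ Finset.range (2 * (2 * P)), SlabKernel.plaqWt (SlabKernel.wilsonWt ρ β)
        (rungAt (0 : TiltedSite d i j (2 * P) (2 * P) L)) (loAt 0) (upAt 0) t U := fun U => rfl
  simp_rw [hA]
  unfold productHaar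
  rw [SlabKernel.integral_mul_annulus (r := rungAt (0 : TiltedSite d i j (2 * P) (2 * P) L)) (a := loAt 0) (b := upAt 0)
    hωc hωz hm2 (by simpa using rungAt_add_two_mul hij (0 : TiltedSite d i j (2 * P) (2 * P) L) 0) (rungAt_inj hij 0)
    (fun t => continuous_apply _) (fun t => continuous_apply _) (fun t s U z => loAt_update hij 0 0 t s U z)
    (fun t s U z => upAt_update hij 0 0 t s U z) (h := h₁) (hhm.mul hpUm)
    (K := Ch * C ^ (2 * (2 * P))) (fun U => by
      rw [hh₁, norm_mul]; exact mul_le_mul (hhb U) (hpUb U) (norm_nonneg _) ((norm_nonneg _).trans (hhb U)))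
    (fun s U z => by simp only [hh₁, hMid_update_rung ρ hP hij hd β hFo (Or.inl (map_zero _)) s U z, hpUu])]
  -- Step B: the upper annulus, against `h₂ = h · k₀`
  set k₀ : Config (TiltedSite d i j (2 * P) (2 * P) L) d G → ℂ := fun U =>
    (SlabKernel.slabKernel (psiW P ρ β) (SlabKernel.oprod (loAt (0 : TiltedSite d i j (2 * P) (2 * P) L)) (2 * (2 * P)) U)
      (wLo U) : ℂ) with hk₀
  have hkc : Continuous fun q : G × G => SlabKernel.slabKernel (psiW P ρ β) q.1 q.2 :=
    SlabKernel.continuous_uncurry_slabKernel hψc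
  obtain ⟨Ck, hCk⟩ := (isCompact_univ (X := G × G)).exists_bound_of_continuousOn hkc.continuousOn
  have hlo0 : Continuous (SlabKernel.oprod (loAt (G := G) (0 : TiltedSite d i j (2 * P) (2 * P) L)) (2 * (2 * P))) :=
    SlabKernel.continuous_oprod (fun t => continuous_apply _) _
  have hk₀m : Measurable k₀ := (Complex.continuous_ofReal.comp (hkc.comp (hlo0.prodMk continuous_wLo_wUp.1))).measurable
  have hk₀b : ∀ U, ‖k₀ U‖ ≤ Ck := fun U => by rw [hk₀, Complex.norm_real]; exact hCk (_, _) (Set.mem_univ _)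
  have hk₀u : ∀ s U z, k₀ (update U (rungAt (layerSite d L P : TiltedSite d i j (2 * P) (2 * P) L) s) z) = k₀ U :=
    fun s U z => by
      simp only [hk₀, wLo, SlabKernel.oprod_update (fun t U z => loAt_update hij _ _ t s U z),
        SlabKernel.oprod_update (fun t U z => upAt_update hij _ _ t s U z)]
  set h₂ : Config (TiltedSite d i j (2 * P) (2 * P) L) d G → ℂ := fun U => hMid ρ β F hij U * k₀ U with hh₂
  have hB : ∀ U, h₁ U * (SlabKernel.slabKernel (SlabKernel.convPow (SlabKernel.wilsonWt ρ β) (2 * P))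
      (SlabKernel.oprod (loAt (0 : TiltedSite d i j (2 * P) (2 * P) L)) (2 * (2 * P)) U)
      (SlabKernel.oprod (upAt (0 : TiltedSite d i j (2 * P) (2 * P) L)) (2 * (2 * P)) U) : ℂ) = h₂ U *
      ∏ t ∈ Finset.range (2 * (2 * P)), SlabKernel.plaqWt (SlabKernel.wilsonWt ρ β)
        (rungAt (layerSite d L P)) (loAt (layerSite d L P)) (upAt (layerSite d L P)) t U := fun U => by
    simp only [hh₁, hh₂, hpU, hk₀, wLo, psiW]; ring
  simp_rw [hB]
  rw [SlabKernel.integral_mul_annulus (r := rungAt (layerSite d L P : TiltedSite d i j (2 * P) (2 * P) L))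
    (a := loAt (layerSite d L P)) (b := upAt (layerSite d L P)) hωc hωz hm2
    (by simpa using rungAt_add_two_mul hij (layerSite d L P : TiltedSite d i j (2 * P) (2 * P) L) 0) (rungAt_inj hij _)
    (fun t => continuous_apply _) (fun t => continuous_apply _) (fun t s U z => loAt_update hij _ _ t s U z)
    (fun t s U z => upAt_update hij _ _ t s U z) (h := h₂) (hhm.mul hk₀m) (K := Ch * Ck)
    (fun U => by rw [hh₂, norm_mul]; exact mul_le_mul (hhb U) (hk₀b U) (norm_nonneg _) ((norm_nonneg _).trans (hhb U)))
    (fun s U z => by simp only [hh₂, hMid_update_rung ρ hP hij hd β hFo (Or.inr axisCoord_layerSite) s U z, hk₀u])]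
  -- Step C: the lower slab is exact, the upper one twisted
  refine integral_congr_ae (ae_of_all _ fun U => ?_)
  have hfold : SlabKernel.convPow (SlabKernel.wilsonWt ρ β) (2 * P) = psiW P ρ β := rfl
  simp only [hh₂, hk₀, wLo, wUp, hfold]
  rw [← oprod_upAt_zero_configMidReflect hij (2 * (2 * P)) U, SlabKernel.slabKernel_symm hψc hψz hψi,
    oprod_upAt_eq_conj hij U, SlabKernel.slabKernel_conj_right, mul_assoc]

/-! ## The main theorem -/

/-- The observable of the mechanism at the feature parameters `(u, u')`:
`Ψ_{u,u'} = g · e_ψ(w₁, u) · e_ψ(w_P, u')`. -/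
def psiMid (β : ℝ) (F : Config (TiltedSite d i j (2 * P) (2 * P) L) d G → ℂ) (u u' : G)
    (U : Config (TiltedSite d i j (2 * P) (2 * P) L) d G) : ℂ :=
  gMid ρ β F U * (SlabKernel.featureMap (psiW P ρ β) (wLo U) u : ℂ) * (SlabKernel.featureMap (psiW P ρ β) (wUp U) u' : ℂ)

/-- **Pointwise in the feature parameters, the mechanism applies** (empty shared block, no crossing
links): `0 ≤ ∫ Ψ_{u,u'}(U) conj Ψ_{u,u'}(Θ_mid U) dU`. [folklore] -/
theorem integral_psiMid_nonneg [DecidableEq (TiltedSite d i j (2 * P) (2 * P) L)] (hP : 2 ≤ P) (hij : i ≠ j)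
    (hd : ∀ k : Fin d, k = i ∨ k = j) (hρ : Continuous ρ) (β : ℝ)
    {F : Config (TiltedSite d i j (2 * P) (2 * P) L) d G → ℂ} (hFm : Measurable F) {CF : ℝ} (hFb : ∀ U, ‖F U‖ ≤ CF)
    (hFo : IsMidObservable (tiltedUnit d i j (2 * P) (2 * P) L) P (axisCoord d L (2 * P)) F) (u u' : G) :
    0 ≤ ∫ U, psiMid ρ β F u u' U * conj (psiMid ρ β F u u' (configMidReflect (tiltedUnit d i j (2 * P) (2 * P) L) i
      (tiltedAxisFlip d L (2 * P) hij) U)) ∂(productHaar (TiltedSite d i j (2 * P) (2 * P) L) d G) := by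
  haveI : IsProbabilityMeasure (haarProbability G) := CompactGroup.isProbabilityMeasure_haarMeasure_top
  obtain ⟨hgm, Cg, hgb⟩ := measurable_gMid_and_bound ρ hρ β hFm hFb
  have hψc : Continuous (psiW P ρ β) := SlabKernel.continuous_convPow (SlabKernel.continuous_wilsonWt ρ hρ β) _
  obtain ⟨Cψ, -, hCψ⟩ := Literature.MathematicalPhysics.QuantumLattice.exists_forall_abs_le_of_continuous hψc
  obtain ⟨hw1, hwP⟩ := continuous_wLo_wUp (L := L) (P := P) (i := i) (j := j) (d := d) (G := G)
  have hΨm : Measurable (psiMid ρ β F u u') :=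
    (hgm.mul (Complex.measurable_ofReal.comp ((SlabKernel.continuous_featureMap_left hψc u).comp hw1).measurable)).mul
      (Complex.measurable_ofReal.comp ((SlabKernel.continuous_featureMap_left hψc u').comp hwP).measurable)
  have hCψ0 : 0 ≤ Cψ := (abs_nonneg _).trans (hCψ 1)
  have hΨb : ∀ U, ‖psiMid ρ β F u u' U‖ ≤ Cg * Cψ * Cψ := fun U => by
    rw [psiMid, norm_mul, norm_mul, Complex.norm_real, Complex.norm_real, Real.norm_eq_abs, Real.norm_eq_abs]
    exact mul_le_mul (mul_le_mul (hgb U) (SlabKernel.abs_featureMap_le hCψ _ _) (abs_nonneg _)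
      ((norm_nonneg _).trans (hgb U))) (SlabKernel.abs_featureMap_le hCψ _ _) (abs_nonneg _)
      (mul_nonneg ((norm_nonneg _).trans (hgb U)) hCψ0)
  have hΨdep : DependsOn (psiMid ρ β F u u') ((posBlockM d i j L P ∪ ∅ ∪ ∅ : Finset _) : Set _) := by
    intro U V hUV
    simp only [Finset.union_empty] at hUV
    have hpos : ∀ l, IsMidPosLink (tiltedUnit d i j (2 * P) (2 * P) L) P (axisCoord d L (2 * P)) l → U l = V l :=
      fun l hl => hUV l (by rw [Finset.mem_coe]; exact (isMidPosLink_iff_mem_posBlockM hP hij hd l).1 hl)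
    have h1 : wLo U = wLo V := by
      unfold wLo SlabKernel.oprod
      congr 1
      refine List.map_congr_left fun t _ => hUV _ ?_
      rw [Finset.mem_coe]
      refine jLink_mem_posBlockM hP (Or.inl ?_)
      rw [axisCoord_add_tiltedUnit, if_pos rfl, axisCoord_cyc hij, map_zero, zero_add]
    have h2 : wUp U = wUp V := by
      unfold wUp SlabKernel.oprod
      congr 1
      refine List.map_congr_left fun t _ => hUV _ ?_
      rw [Finset.mem_coe]
      exact jLink_mem_posBlockM hP (Or.inr (by rw [axisCoord_cyc hij, axisCoord_layerSite]))
    simp only [psiMid, gMid_eq_of_posLinks ρ hP β hFo hpos, h1, h2]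
  have key := integral_splice_mul_conj_comp_of_shared_nonneg (haarProbability G) ∅ (posBlockM d i j L P) ∅ _
    (measurePreserving_configMidReflect_flip (L := L) (P := P) (G := G) hij) (fun U l hl => by simp at hl)
    (fun l hl => dependsOn_configMidReflect_apply hP hij hd l hl) (Finset.disjoint_empty_left _)
    (Finset.disjoint_empty_left _) hΨm hΨb hΨdep
  simp only [splice_eq_piecewise, Finset.piecewise_empty] at key
  unfold productHaar
  rwa [integral_fun_fst (fun U => psiMid ρ β F u u' U * conj (psiMid ρ β F u u' (configMidReflect
      (tiltedUnit d i j (2 * P) (2 * P) L) i (tiltedAxisFlip d L (2 * P) hij) U))), probReal_univ, one_smul] at key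

/-- **After the annuli: the double Gram form is non-negative**,
`0 ≤ ∫ h · k_ψ(w₁, w₁∘Θ) · k_ψ(w_P, w_P∘Θ) dμ₀` (Fubini over the two feature parameters). [folklore] -/
theorem integral_hMid_kernels_nonneg [DecidableEq (TiltedSite d i j (2 * P) (2 * P) L)] (hP : 2 ≤ P) (hij : i ≠ j)
    (hd : ∀ k : Fin d, k = i ∨ k = j) (hρ : Continuous ρ) (β : ℝ)
    {F : Config (TiltedSite d i j (2 * P) (2 * P) L) d G → ℂ} (hFm : Measurable F) {CF : ℝ} (hFb : ∀ U, ‖F U‖ ≤ CF)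
    (hFo : IsMidObservable (tiltedUnit d i j (2 * P) (2 * P) L) P (axisCoord d L (2 * P)) F) :
    0 ≤ ∫ U, hMid ρ β F hij U * (SlabKernel.slabKernel (psiW P ρ β) (wLo U)
        (wLo (configMidReflect (tiltedUnit d i j (2 * P) (2 * P) L) i (tiltedAxisFlip d L (2 * P) hij) U)) : ℂ) *
      (SlabKernel.slabKernel (psiW P ρ β) (wUp U)
        (wUp (configMidReflect (tiltedUnit d i j (2 * P) (2 * P) L) i (tiltedAxisFlip d L (2 * P) hij) U)) : ℂ)
      ∂(productHaar (TiltedSite d i j (2 * P) (2 * P) L) d G) := by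
  haveI : IsProbabilityMeasure (haarProbability G) := CompactGroup.isProbabilityMeasure_haarMeasure_top
  haveI : IsFiniteMeasure (productHaar (TiltedSite d i j (2 * P) (2 * P) L) d G) := by unfold productHaar; infer_instance
  obtain ⟨hhm, Ch, hhb⟩ := measurable_hMid_and_bound ρ hij hρ β hFm hFb
  have hωc := SlabKernel.continuous_wilsonWt ρ hρ β
  have hωz := SlabKernel.wilsonWt_central ρ β
  have hψc : Continuous (psiW P ρ β) := SlabKernel.continuous_convPow hωc _
  have hψz : ∀ g h, psiW P ρ β (h * g * h⁻¹) = psiW P ρ β g := SlabKernel.convPow_central hωz (2 * P)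
  have hψi : ∀ g, psiW P ρ β g⁻¹ = psiW P ρ β g :=
    SlabKernel.convPow_inv hωz (SlabKernel.wilsonWt_inv ρ hρ β) (2 * P)
  obtain ⟨hw1, hwP⟩ := continuous_wLo_wUp (L := L) (P := P) (i := i) (j := j) (d := d) (G := G)
  have hkc : Continuous fun q : G × G => SlabKernel.slabKernel (psiW P ρ β) q.1 q.2 :=
    SlabKernel.continuous_uncurry_slabKernel hψc
  obtain ⟨Ck, hCk⟩ := (isCompact_univ (X := G × G)).exists_bound_of_continuousOn hkc.continuousOn
  obtain ⟨Cψ, -, hCψ⟩ := Literature.MathematicalPhysics.QuantumLattice.exists_forall_abs_le_of_continuous hψc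
  -- Step 4: Gram form of the upper kernel
  obtain ⟨Φ₁, hΦ₁⟩ : ∃ Φ : Config (TiltedSite d i j (2 * P) (2 * P) L) d G → ℂ, Φ = fun U => hMid ρ β F hij U *
    (SlabKernel.slabKernel (psiW P ρ β) (wLo U)
      (wLo (configMidReflect (tiltedUnit d i j (2 * P) (2 * P) L) i (tiltedAxisFlip d L (2 * P) hij) U)) : ℂ) := ⟨_, rfl⟩
  have hΘc := continuous_configMidReflect_flip (L := L) (P := P) (G := G) hij
  have hk1c : Continuous fun U : Config (TiltedSite d i j (2 * P) (2 * P) L) d G =>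
      (SlabKernel.slabKernel (psiW P ρ β) (wLo U)
        (wLo (configMidReflect (tiltedUnit d i j (2 * P) (2 * P) L) i (tiltedAxisFlip d L (2 * P) hij) U)) : ℂ) :=
    Complex.continuous_ofReal.comp (hkc.comp (hw1.prodMk (hw1.comp hΘc)))
  have hΦ₁m : Measurable Φ₁ := by
    rw [hΦ₁]
    exact hhm.mul hk1c.measurable
  have hΦ₁b : ∀ U, ‖Φ₁ U‖ ≤ Ch * Ck := fun U => by
    rw [hΦ₁, norm_mul, Complex.norm_real]
    exact mul_le_mul (hhb U) (hCk (_, _) (Set.mem_univ _)) (norm_nonneg _) ((norm_nonneg _).trans (hhb U))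
  have hsplit₁ : ∀ U, hMid ρ β F hij U * (SlabKernel.slabKernel (psiW P ρ β) (wLo U)
        (wLo (configMidReflect (tiltedUnit d i j (2 * P) (2 * P) L) i (tiltedAxisFlip d L (2 * P) hij) U)) : ℂ) *
      (SlabKernel.slabKernel (psiW P ρ β) (wUp U)
        (wUp (configMidReflect (tiltedUnit d i j (2 * P) (2 * P) L) i (tiltedAxisFlip d L (2 * P) hij) U)) : ℂ) =
      Φ₁ U * (SlabKernel.slabKernel (psiW P ρ β) (wUp U)
        (wUp (configMidReflect (tiltedUnit d i j (2 * P) (2 * P) L) i (tiltedAxisFlip d L (2 * P) hij) U)) : ℂ) :=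
    fun U => by rw [hΦ₁]
  simp_rw [hsplit₁]
  rw [SlabKernel.integral_mul_slabKernel_eq (productHaar (TiltedSite d i j (2 * P) (2 * P) L) d G) (Φ := Φ₁)
    (a := wUp) (b := fun U => wUp (configMidReflect (tiltedUnit d i j (2 * P) (2 * P) L) i (tiltedAxisFlip d L (2 * P) hij) U))
    hψc hψz hψi hΦ₁m hΦ₁b hwP.measurable (hwP.comp hΘc).measurable]
  refine integral_nonneg_of_complex fun u' => ?_
  -- Step 5: Gram form of the lower kernel
  obtain ⟨E, hE⟩ : ∃ E : Config (TiltedSite d i j (2 * P) (2 * P) L) d G → ℂ, E = fun U =>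
    (SlabKernel.featureMap (psiW P ρ β) (wUp U) u' : ℂ) *
      (SlabKernel.featureMap (psiW P ρ β)
        (wUp (configMidReflect (tiltedUnit d i j (2 * P) (2 * P) L) i (tiltedAxisFlip d L (2 * P) hij) U)) u' : ℂ) := ⟨_, rfl⟩
  have hEc : Continuous fun U : Config (TiltedSite d i j (2 * P) (2 * P) L) d G =>
      (SlabKernel.featureMap (psiW P ρ β) (wUp U) u' : ℂ) *
        (SlabKernel.featureMap (psiW P ρ β)
          (wUp (configMidReflect (tiltedUnit d i j (2 * P) (2 * P) L) i (tiltedAxisFlip d L (2 * P) hij) U)) u' : ℂ) :=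
    (Complex.continuous_ofReal.comp ((SlabKernel.continuous_featureMap_left hψc u').comp hwP)).mul
      (Complex.continuous_ofReal.comp ((SlabKernel.continuous_featureMap_left hψc u').comp (hwP.comp hΘc)))
  have hEm : Measurable E := by
    rw [hE]
    exact hEc.measurable
  have hCψ0 : 0 ≤ Cψ := (abs_nonneg _).trans (hCψ 1)
  have hEb : ∀ U, ‖E U‖ ≤ Cψ * Cψ := fun U => by
    rw [hE, norm_mul, Complex.norm_real, Complex.norm_real, Real.norm_eq_abs, Real.norm_eq_abs]
    exact mul_le_mul (SlabKernel.abs_featureMap_le hCψ _ _) (SlabKernel.abs_featureMap_le hCψ _ _) (abs_nonneg _) hCψ0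
  obtain ⟨Φ₂, hΦ₂⟩ : ∃ Φ : Config (TiltedSite d i j (2 * P) (2 * P) L) d G → ℂ, Φ = fun U => hMid ρ β F hij U * E U :=
    ⟨_, rfl⟩
  have hreorder : ∀ U, Φ₁ U * ((SlabKernel.featureMap (psiW P ρ β) (wUp U) u' : ℂ) *
      (SlabKernel.featureMap (psiW P ρ β)
        (wUp (configMidReflect (tiltedUnit d i j (2 * P) (2 * P) L) i (tiltedAxisFlip d L (2 * P) hij) U)) u' : ℂ)) =
      Φ₂ U * (SlabKernel.slabKernel (psiW P ρ β) (wLo U)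
        (wLo (configMidReflect (tiltedUnit d i j (2 * P) (2 * P) L) i (tiltedAxisFlip d L (2 * P) hij) U)) : ℂ) :=
    fun U => by simp only [hΦ₁, hΦ₂, hE]; ring
  simp_rw [hreorder]
  rw [SlabKernel.integral_mul_slabKernel_eq (productHaar (TiltedSite d i j (2 * P) (2 * P) L) d G)
    (Φ := Φ₂) (a := wLo)
    (b := fun U => wLo (configMidReflect (tiltedUnit d i j (2 * P) (2 * P) L) i (tiltedAxisFlip d L (2 * P) hij) U))
    hψc hψz hψi (by rw [hΦ₂]; exact hhm.mul hEm) (K := Ch * (Cψ * Cψ))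
    (fun U => by rw [hΦ₂, norm_mul]; exact mul_le_mul (hhb U) (hEb U) (norm_nonneg _) ((norm_nonneg _).trans (hhb U)))
    hw1.measurable (hw1.comp hΘc).measurable]
  refine integral_nonneg_of_complex fun u => ?_
  -- Step 6: pointwise in `(u, u')`
  have key := integral_psiMid_nonneg ρ hP hij hd hρ β hFm hFb hFo u u'
  have heq : ∀ U, Φ₂ U * ((SlabKernel.featureMap (psiW P ρ β) (wLo U) u : ℂ) *
      (SlabKernel.featureMap (psiW P ρ β)
        (wLo (configMidReflect (tiltedUnit d i j (2 * P) (2 * P) L) i (tiltedAxisFlip d L (2 * P) hij) U)) u : ℂ)) =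
      psiMid ρ β F u u' U * conj (psiMid ρ β F u u' (configMidReflect (tiltedUnit d i j (2 * P) (2 * P) L) i
        (tiltedAxisFlip d L (2 * P) hij) U)) := fun U => by
    simp only [hΦ₂, hE, psiMid, hMid, map_mul, Complex.conj_ofReal]; ring
  simp_rw [heq]
  exact key

/-- **Reflection positivity of the hybrid LINK mirror in two dimensions.** On the square tilted box
`ℤ^d/Γ(2P, 2P, L)` with `d = 2` directions (`∀ k, k = i ∨ k = j`), `P ≥ 2`, for a compact second countable
group `G`, a continuous matrix representation `ρ` and EVERY real `β`: for every bounded measurable observable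
`F` of the closed half `{1 ≤ x_i ≤ P}`, `0 ≤ ∫ conj F(Θ_mid U) F(U) dμ_β(U)`, `Θ_mid` the link mirror
`x_i ↦ 1 - x_i`. (In `d ≥ 3` this fails for `β > 0`: `not_tiltedBox_midAxisRP`.) Small new positive result;
2D YM gluing. -/
theorem tiltedBox_midAxisRP_twoDim (hP : 2 ≤ P) (hij : i ≠ j) (hd : ∀ k : Fin d, k = i ∨ k = j) (hρ : Continuous ρ)
    (β : ℝ) (F : Config (TiltedSite d i j (2 * P) (2 * P) L) d G → ℂ) (hFm : Measurable F)
    (hFb : ∃ C : ℝ, ∀ U, ‖F U‖ ≤ C)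
    (hFo : IsMidObservable (tiltedUnit d i j (2 * P) (2 * P) L) P (axisCoord d L (2 * P)) F) :
    0 ≤ ∫ U, conj (F (configMidReflect (tiltedUnit d i j (2 * P) (2 * P) L) i (tiltedAxisFlip d L (2 * P) hij) U)) * F U
      ∂(gibbs ρ (tiltedUnit d i j (2 * P) (2 * P) L) β) := by
  classical
  obtain ⟨CF, hFb⟩ := hFb
  -- Step 0: from the Wilson measure to the Boltzmann weight
  have hZ := normaliser_pos (A := TiltedSite d i j (2 * P) (2 * P) L) (G := G) ρ hρ (tiltedUnit d i j (2 * P) (2 * P) L) β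
  rw [integral_gibbs]
  simp_rw [Complex.real_smul, Complex.ofReal_div, div_eq_mul_inv, mul_comm (Complex.ofReal _) ((_ : ℂ)⁻¹), mul_assoc]
  rw [integral_const_mul]
  refine mul_nonneg (by rw [← Complex.ofReal_inv]; exact Complex.zero_le_real.2 (inv_nonneg.2 hZ.le)) ?_
  -- Steps 1–3: split, integrate both annuli, remove the twists; Steps 4–6: double Gram form
  simp_rw [boltzmann_split_mid ρ hP hij hd hρ β F]
  rw [integral_const_mul]
  refine mul_nonneg (mul_nonneg (Complex.zero_le_real.2 (Real.exp_pos _).le) (Complex.zero_le_real.2 (Real.exp_pos _).le)) ?_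
  rw [integral_hMid_annuli ρ hP hij hd hρ β hFm hFb hFo]
  exact integral_hMid_kernels_nonneg ρ hP hij hd hρ β hFm hFb hFo

end TwoDim

end TiltedRP

end Summit.QuantumFields.GaugeBoot

end
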